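import Summits.ValiantsHypothesis.ValiantsHypothesis.Theses.IntegralGCT

/-!
# `IntegralGCT.Assembly` (stmt-ValiantsHypothesis-0984) — assembly of route IntegralGCT

The route's assembly item `Assembly`:
`IntegralFlipQP → IntegralPrinciple → GctToVH → ValiantsHypothesis`.
This is pure logic and is literally the type of the route's (sorry-free) deciding theorem
`Summit.ValiantsHypothesis.ValiantsHypothesis.Theses.IntegralGCT.closes`: for each exponent `c`,
`IntegralFlipQP` gives a threshold `n₀` such that every `(n, m)` in the quasi-polynomial padding
window `n ≤ m ≤ 2 ^ ((log₂ n + c) ^ c)` carries a degree `d` admitting no lattice-preserving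
`GL_{m²}`-intertwining map `ℂ[Δ det_m]_d → ℂ[Δ X₀₀^(m-n) per_n]_d`; if the padded permanent were
in `Δ(det_m)`, `IntegralPrinciple` (monotonicity of the integral lattices under the canonical
restriction) would produce such a map; hence the padded permanent is outside `Δ(det_m)` throughout
the window, which is exactly the hypothesis of `GctToVH`, and `GctToVH` returns
`ValiantsHypothesis`. Mulmuley–Sohoni 2001 §4; arXiv:0907.2850 §2 (surjection template). [folklore]
-/

namespace Summit.ValiantsHypothesis.IntegralGCT

open Summit.ValiantsHypothesis.ValiantsHypothesis.Theses.IntegralGCT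

/-- **`Assembly` holds** (item stmt-ValiantsHypothesis-0984, assembly of route IntegralGCT):
`IntegralFlipQP → IntegralPrinciple → GctToVH → ValiantsHypothesis`.
Pure logic: given `c`, the flip supplies `n₀` and, for every `(n, m)` in the window, a degree `d`
with no lattice-preserving intertwiner; membership `pp ∈ Δ(det_m)` would contradict this via
`IntegralPrinciple det_m pp m d`; the resulting quasi-polynomial non-membership statement is the
hypothesis of `GctToVH`. [folklore] -/
theorem assembly_proof :
    Summit.ValiantsHypothesis.ValiantsHypothesis.Theses.IntegralGCT.Assembly := by
  unfold Summit.ValiantsHypothesis.ValiantsHypothesis.Theses.IntegralGCT.Assembly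
  intro hFlip hPrinciple hGctToVH
  refine hGctToVH ?_
  intro c
  obtain ⟨n₀, hn₀⟩ := hFlip c
  refine ⟨n₀, ?_⟩
  intro n hn m _inst hnm hm hmem
  obtain ⟨d, hd⟩ := hn₀ n hn m hnm hm
  exact hd (hPrinciple (Literature.Computability.AlgebraicComplexity.detPoly (Fin m) ℂ)
    (Literature.Computability.AlgebraicComplexity.paddedPerPoly ℂ n m) m d hmem)

end Summit.ValiantsHypothesis.IntegralGCT
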